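import Literature.AlgebraicGeometry.HodgeTheory.ComplexOrientationDegreeFormulaReduction
import Literature.AlgebraicGeometry.HodgeTheory.DegreeFormulaBookkeeping
import Literature.AlgebraicGeometry.HodgeTheory.TopHodgeClassesSpannedByPullbacksHolds
import Literature.AlgebraicGeometry.Motives.GenericFinitenessOfDegree
import Literature.AlgebraicGeometry.HodgeTheory.GenericEtalenessOfDegree
import Literature.AlgebraicGeometry.HodgeTheory.FiniteFlatRankOfDegree
import Literature.AlgebraicGeometry.Motives.FiniteEtaleFibreComplexPoints
import Literature.AlgebraicGeometry.Resolution.ResolveRationalMapSmoothProjective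
import Literature.NumberTheory.Transcendental.AnalytificationConnected
import Literature.AlgebraicGeometry.Morphisms.IsoOverOpen
import HarnessLib

/-!
# Fulton's degree formula for the complex orientations — proved

Family `hodge`, layer `Literature/AlgebraicGeometry/HodgeTheory`. DISCHARGE of the named fact
`Fulton1998_degreeFormula_complexOrientation` (`HodgeTheory/ComplexOrientationCycleClassFacts`; Fulton,
*Intersection Theory*, Lemma 19.1.2 for the complex orientations: `g_* 1_V = k • τ_* 1_W` in
`H^{2e}(X(ℂ); ℂ)` for `g : V ⟶ X` of degree `k` and `τ : W ⟶ X` of degree `1` onto the same subvariety).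
The tree's reduction `Fulton1998_degreeFormula_complexOrientation_of` (`ComplexOrientationDegreeFormulaReduction`,
topological half proved there) leaves two statements of algebraic geometry, assembled here from the
wave-3 lemmas of the crux line `regime-split-middle-step` (stmt-HodgeConjecture-2782):

* `degreeFormula_generalFibre` (= hypothesis `h4`, Harris Prop. 7.16: a general fibre of a degree-`k`
  morphism of smooth projective `d`-folds has exactly `k` complex points) from generic finiteness
  (`Motives.exists_isFinite_morphismRestrict_of_map_primeCycle_eq_nsmul`), generic étaleness (`exists_etale_morphismRestrict_of_map_primeCycle_eq_nsmul`), the rank over the finite flat locus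
  (`finrank_morphismRestrict_eq_of_map_primeCycle_eq_nsmul`), a complex point in the locus (`ComplexPoints.exists_pt_mem`) and the fibre count
  (`Motives.exists_fin_complexPoints_fibre_of_finite_etale_finrank_eq`);
* `degreeFormula_resolveRationalMap` (= hypothesis `h5`, Hartshorne II Ex. 7.17.3 + Hironaka: resolving
  `τ⁻¹ ∘ g`) from the bookkeeping `base_eq_and_residueFieldMap_surjective_of_map_primeCycle`, the geometry
  `Resolution.exists_isSmoothProjective_isBirational_comp_eq_of_residueFieldMap_surjective` and the degree bookkeeping `exists_resolution_of_degree_eq_of_comp_eq`;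
* `Fulton1998_degreeFormula_complexOrientation_holds` — the named fact;
* corollaries: `Voisin2003_cycleClass_div_eq_zero_complexOrientation_holds` (Voisin II Lemma 9.18 for the
  complex orientations — the named fact of `ComplexOrientationCycleClassFacts`, through
  `Voisin2003_cycleClass_div_eq_zero_complexOrientation_of_degreeFormula` and the landed spanning theorem) and
  `exists_gysinFormalism_isGysinHodgeCompatible_complexOrientation_holds` (a Gysin / cycle-class formalism
  with Hodge-compatible Gysin morphisms EXISTS, unconditionally).

## References

* [Fulton1998] W. Fulton, Intersection Theory, 2nd ed., Springer 1998, Lemma 19.1.2, Example 1.7.4.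
* [Harris1992] J. Harris, Algebraic Geometry: A First Course, GTM 133, Springer 1992, Prop. 7.16.
* [Hartshorne1977] R. Hartshorne, Algebraic Geometry, GTM 52, Springer 1977, II Ex. 7.17.3, III Cor. 10.7.
* [Hironaka1964] H. Hironaka, Resolution of singularities …, Ann. of Math. 79 (1964), Main Theorem I.
-/

noncomputable section

open CategoryTheory AlgebraicGeometry Order Set
open Literature.AlgebraicGeometry.Motives

namespace Literature.AlgebraicGeometry.HodgeTheory

section HodgeTheory

/-- **General fibres of a degree-`k` morphism of smooth projective `d`-folds over `ℂ` have exactly `k`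
complex points** (hypothesis `h4` of `Fulton1998_degreeFormula_complexOrientation_of`): over the
intersection of the generic-finiteness and generic-étaleness opens with the given `V`, `q` is finite
étale of rank `k`, and the fibre of a complex point there has `k` complex points.
[cite: Harris1992, Prop. 7.16] [cite: Fulton1998, Example 1.7.4] -/
theorem degreeFormula_generalFibre :
    ∀ ⦃d : ℕ⦄ ⦃T W : Motives.SchemeOver ℂ⦄ (hT : IsSmoothProjective d T)
      (hW : IsSmoothProjective d W) (q : T ⟶ W) [QuasiCompact q.left] ⦃θ : T.left⦄ ⦃ω : W.left⦄,
      IsGenericPoint θ Set.univ → IsGenericPoint ω Set.univ → ∀ ⦃k : ℕ⦄, 0 < k →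
      AlgebraicCycle.map q.left height height (Motives.primeCycle θ) = k • Motives.primeCycle ω →
      ∀ V : W.left.Opens, (V : Set W.left).Nonempty →
        ∃ b : ComplexPoints W, b.pt ∈ V ∧ ∃ v : Fin k → ComplexPoints T,
          Function.Injective v ∧ (AlgPoints.map q) ⁻¹' {b} = Set.range v := by
  intro d T W hT hW q _ θ ω hθ hω k hk hq V hV
  obtain ⟨U₁, hω₁, hfin⟩ := Motives.exists_isFinite_morphismRestrict_of_map_primeCycle_eq_nsmul hT hW q hθ hω hk hq
  obtain ⟨U₂, hω₂, het⟩ := exists_etale_morphismRestrict_of_map_primeCycle_eq_nsmul hT hW q hθ hω hk hq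
  have hωV : ω ∈ V := (hω.mem_open_set_iff V.isOpen).mpr (by simpa using hV)
  let U : W.left.Opens := V ⊓ U₁ ⊓ U₂
  have hωU : ω ∈ U := ⟨⟨hωV, hω₁⟩, hω₂⟩
  haveI : IsFinite (q.left ∣_ U) :=
    Literature.AlgebraicGeometry.Morphisms.of_morphismRestrict_of_le @IsFinite q.left
      (show U ≤ U₁ from inf_le_left.trans inf_le_right) hfin
  haveI : Etale (q.left ∣_ U) :=
    Literature.AlgebraicGeometry.Morphisms.of_morphismRestrict_of_le @Etale q.left (show U ≤ U₂ from inf_le_right) het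
  haveI : Flat (q.left ∣_ U) := ((Etale.iff_flat_and_formallyUnramified).mp inferInstance).1
  have hrank := finrank_morphismRestrict_eq_of_map_primeCycle_eq_nsmul hT hW q hθ hω hk hq U hωU
  haveI := hW.smoothOfRelativeDimension
  haveI : LocallyOfFiniteType W.hom := by
    haveI : Smooth W.hom := SmoothOfRelativeDimension.smooth d _
    infer_instance
  obtain ⟨b, hb⟩ := ComplexPoints.exists_pt_mem (X := W) (⟨ω, hωU⟩ : (U : Set W.left).Nonempty)
    U.isOpen.isLocallyClosed
  obtain ⟨v, hv, hfib⟩ := Motives.exists_fin_complexPoints_fibre_of_finite_etale_finrank_eq hT hW q U hrank b hb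
  exact ⟨b, (inf_le_left.trans inf_le_left : U ≤ V) hb, v, hv, hfib⟩

/-- **Resolving the rational map `τ⁻¹ ∘ g`** (hypothesis `h5` of
`Fulton1998_degreeFormula_complexOrientation_of`): a smooth projective `T` with `p : T ⟶ V` birational and
`q : T ⟶ W` of degree `k` making the square commute. [cite: Hartshorne1977, II Example 7.17.3]
[cite: Hironaka1964, Main Theorem I] -/
theorem degreeFormula_resolveRationalMap :
    ∀ ⦃n d e : ℕ⦄ ⦃X V W : Motives.SchemeOver ℂ⦄ (hX : IsSmoothProjective n X)
      (hV : IsSmoothProjective d V) (hW : IsSmoothProjective d W) (_hde : d + e = n)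
      (g : V ⟶ X) (τ : W ⟶ X) [QuasiCompact g.left] [QuasiCompact τ.left] ⦃η : V.left⦄ ⦃ω : W.left⦄,
      IsGenericPoint η Set.univ → IsGenericPoint ω Set.univ → ∀ ⦃z : X.left⦄ ⦃k : ℕ⦄, 0 < k →
      AlgebraicCycle.map g.left height height (Motives.primeCycle η) = k • Motives.primeCycle z →
      AlgebraicCycle.map τ.left height height (Motives.primeCycle ω) = Motives.primeCycle z →
      ∃ (T : Motives.SchemeOver ℂ) (_ : IsSmoothProjective d T) (p : T ⟶ V) (q : T ⟶ W)
        (_ : QuasiCompact q.left) (θ : T.left), IsGenericPoint θ Set.univ ∧ p ≫ g = q ≫ τ ∧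
        Resolution.IsBirational p.left ∧
        AlgebraicCycle.map q.left height height (Motives.primeCycle θ) = k • Motives.primeCycle ω := by
  intro n d e X V W hX hV hW hde g τ _ _ η ω hη hω z k hk hg hτ
  obtain ⟨hgz, hτz, hsurj⟩ :=
    base_eq_and_residueFieldMap_surjective_of_map_primeCycle hX hV hW g τ hη hω hk hg hτ
  obtain ⟨T, d', hT, p, q, hsq, hbir⟩ := Resolution.exists_isSmoothProjective_isBirational_comp_eq_of_residueFieldMap_surjective hX hV hW g τ hη hω (hgz.trans hτz.symm) hsurj
  exact exists_resolution_of_degree_eq_of_comp_eq hX hV hW hT hde g τ p q hη hω hk hg hτ hsq hbir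

/-- **Fulton's degree formula for the complex orientations, PROVED** (discharge of the named fact
`Fulton1998_degreeFormula_complexOrientation`): `g_* 1_V = k • τ_* 1_W` in `H^{2e}(X(ℂ); ℂ)` for
`g : V ⟶ X` of degree `k` and `τ : W ⟶ X` of degree `1` onto the same subvariety.
[cite: Fulton1998, Lemma 19.1.2] -/
theorem Fulton1998_degreeFormula_complexOrientation_holds : Fulton1998_degreeFormula_complexOrientation :=
  Fulton1998_degreeFormula_complexOrientation_of degreeFormula_generalFibre degreeFormula_resolveRationalMap

/-- **Voisin II, Lemma 9.18 for the complex orientations, PROVED** (discharge of the named fact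
`Voisin2003_cycleClass_div_eq_zero_complexOrientation`: the cycle class of the divisor of a rational
function vanishes, `[div φ] = 0` in `H^{2p}(X(ℂ); ℂ)`), from the degree formula and the landed spanning
theorem (`Voisin2003_cycleClass_div_eq_zero_complexOrientation_of_degreeFormula`).
[cite: VoisinHodgeII2003, Lemma 9.18] [cite: Fulton1998, Lemma 19.1.2] -/
theorem Voisin2003_cycleClass_div_eq_zero_complexOrientation_holds :
    Voisin2003_cycleClass_div_eq_zero_complexOrientation :=
  Voisin2003_cycleClass_div_eq_zero_complexOrientation_of_degreeFormula
    Fulton1998_degreeFormula_complexOrientation_holds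

/-- **A Gysin / cycle-class formalism with Hodge-compatible Gysin morphisms exists** (the complex
orientations), unconditionally: `exists_gysinFormalism_isGysinHodgeCompatible_complexOrientation` with both its
named-fact hypotheses discharged. [cite: VoisinHodgeII2003, Lemma 9.18 and Prop. 10.26] [cite: Fulton1998, Lemma 19.1.2] -/
theorem exists_gysinFormalism_isGysinHodgeCompatible_complexOrientation_holds :
    ∃ G : GysinFormalism, G.IsGysinHodgeCompatible :=
  (exists_gysinFormalism_isGysinHodgeCompatible_complexOrientation
    Fulton1998_degreeFormula_complexOrientation_holds
    Voisin2003_cycleClass_div_eq_zero_complexOrientation_holds).imp fun _ h ↦ h.1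

end HodgeTheory

end Literature.AlgebraicGeometry.HodgeTheory

end
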